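/-
Copyright (c) 2026 the pub-hodgecm-mathlib formalisation cell (harness21).  Prover seat hodgecm-mathlib-F0P3a-p04 (g30): road M6 «ROW 2 ★ DYADIC TWIN» (LEAD F0P3a-plan T14-66),
dealer LH4-plan (g8) WORD #62∕#65 «R1u» = the MODEL-FREE wrapper of ★ p852866 `DepthZeroKappaTransferTypeTwoRowTwoPlaceWildUnit` (the W-UNIT twin of ★ tame
`…RowTwoPlace.ncard_selfDual_cyclic_typeTwo_eq_ite` :244, token-parallel sibling of LH10-p01 (g10)'s R1 `…RowTwoPlaceWildOddFree`); 2026-09-02.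
-/
import Literature.NumberTheory.Rogawski1990.DepthZeroKappaTransferTypeTwoRowTwoPlaceWildUnit   -- ★ p852866 (this seat): `ncard_selfDual_cyclic_typeTwo_eq_ite_of_model_wildUnit` (brings ★ (D2-β)′, ★ F4-b″, ★ (D5)′, ★ `RamifiedQuadraticDictionaryWild` (W0) + B-p08 `exists_isSquare_inv_mul_coe_of_ne_zero`)
import Literature.NumberTheory.NumberFields.QuadraticRamifiedAtOddValuationPlace              -- ★ QM kit (brings ★ `QuadraticCompletionAtNonsplitPlace`: `numberField_adjoinRoot`, `isQuadraticExtension_adjoinRoot`, `exists_algEquiv_root_eq_neg`, `root_X_sq_sub_C_sq`, `not_isSquare_of_not_isSquare_algebraMap`)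
import HarnessLib

/-!
# The depth-zero κ-transfer, type (2): ROW 2 at ONE PLACE, WILD UNIT-DISCRIMINANT frame — MODEL-FREE (the global quadratic model of the eigen-field is produced inside)

Topic `NumberTheory/Rogawski1990`; namespace `Literature.NumberTheory.Rogawski1990`.  ONE THEOREM (no definition, no instance, no notation, no named fact, no `sorry`); kernel lane
`--supports stmt-HodgeConjecture-24833`.  Cell `pub/hodgecm-mathlib` (D-0151), crux H413; road M6 «ROW 2 ★ DYADIC TWIN» (LEAD F0P3a-plan (g15) T14-66), dealer LH4-plan (g8)
WORD #62∕#65: **R1u** = ★ `ncard_selfDual_cyclic_typeTwo_eq_ite_of_model_wildUnit` (p852866) with the global model binders `{M} c₁ {δ₁} hcδ hδ₁ {m} hm hdm w₁` DISCHARGED: the eigen-field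
`L_w(√(ι d₀))` is the completion of `M = L(√m)` for a global `m` in the square class of `ι d₀` (★ B-p08 `exists_isSquare_inv_mul_coe_of_ne_zero`, any residue characteristic — the tame
wrapper's ★ Q3 `exists_coe_isSquare_inv_mul_and_valued_eq_exp_odd` carried `|2| = 1`), `m` non-square because `ι d₀ = 1 + ι wd` is not (★ (W0) `not_isSquare_one_add_of_valued_four_lt`),
then ★ QM (`numberField_adjoinRoot`, `isQuadraticExtension_adjoinRoot`, `exists_algEquiv_root_eq_neg`).  The W-UNIT FRAME `(y, d₀, wd, k, k₀)` STAYS A BINDER (the exponent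
`N + k − e + n − 1` names `k`, the conductor level `N + k − e` of ★ (D5)′): callers holding only `(hdisc : |t² − 4D| = exp(−2M), hns : ¬ IsSquare (t² − 4D))` obtain the frame from
α2 `LocalFields.exists_skew_sqrt_discriminant_wildUnit` (LH10-p02 (g12)) with `N := M` and `k` existential.  TOKEN-PARALLEL SIBLING of LH10-p01's R1 `…RowTwoPlaceWildOddFree`.
ROW COVERAGE (honest): inhabited only at dyadic `v` (`|4|_v < |wd|_v`).  HONEST LABEL: count-neutral road brick (no organ, no row, no registry act); zero label movement until F5 ★ +
a desk-priced rider; (O4) NOT an organ; (D-UNR)∕(D-RAM) PRINT by D74′; `stub_N6nsDyadic` = PRINT [LS₂]; HC_CM is proved only modulo the 7 printed citations (2 remaining named inputs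
hLiu418 = stmt-HodgeConjecture-24832, h413 = stmt-HodgeConjecture-24833) until rung 0 closes; unconditional local algebra, nothing printed is asserted here.

## References
* [Rogawski1990] J. D. Rogawski, *Automorphic Representations of Unitary Groups in Three Variables* (1990): §4.9 Lemma 4.9.3 p. 56, Prop. 4.9.1 (b) p. 55.
* [Kottwitz1986] R. E. Kottwitz, *Base change for unit elements of Hecke algebras*, Compositio Math. 60 (1986): §3.
* [Jacobowitz1962] R. Jacobowitz, *Hermitian forms over local fields*, Amer. J. Math. 84 (1962): §5, §7, §§9–11.
* [Neukirch1999] J. Neukirch, *Algebraic Number Theory*, Grundlehren 322 (1999): Ch. II (3.4) (density: a global representative of a local square class).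
-/

set_option autoImplicit false

noncomputable section

open NumberField IsDedekindDomain Matrix Polynomial Finset
open scoped MatrixGroups WithZero ValuativeRel

namespace Literature.NumberTheory.Rogawski1990

open ValuativeRel
open Literature.NumberTheory.Automorphic Literature.NumberTheory.Automorphic.UnitaryGroup

open Literature.NumberTheory.GaloisRepresentations Literature.NumberTheory.NumberFields

variable (L : Type) [Field L] [NumberField L] [IsCMField L] {v : HeightOneSpectrum (𝓞 ↥(maximalRealSubfield L))}

set_option synthInstance.maxHeartbeats 200000 in
set_option maxHeartbeats 800000 in
/-- **ROW 2 AT ONE PLACE, WILD UNIT-DISCRIMINANT FRAME, MODEL-FREE.**  ★ `ncard_selfDual_cyclic_typeTwo_eq_ite_of_model_wildUnit`'s statement with the global model of the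
eigen-field produced inside (★ B-p08 + ★ QM); the W-unit frame `4D = t² − y²·ι d₀`, `d₀ = 1 + wd`, `|wd| = q^{−(2k+1)} > |4|`, `σy = −yσD`, `|y| = q^{−N}`, `k₀` a uniformiser of `L⁺_v`
stays a binder (the count names `k`): `#S(τ) = (q+1)·q^{N+k−e+n−1}` if `ord_w(ᵗσ(x₀)Jx₀) + n` is even, else `0`.
[cite: Rogawski1990, §4.9 Lemma 4.9.3 p. 56, Prop. 4.9.1 (b) p. 55] [cite: Kottwitz1986, §3] [cite: Jacobowitz1962, §5, §7, §§9–11] [cite: Neukirch1999, Ch. II (3.4)] -/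
theorem ncard_selfDual_cyclic_typeTwo_eq_ite_wildUnit (w : PlacesOver L v) (hw : IsCMField.complexConj L • w.1 = w.1)
    (hv : Algebra.IsUnramifiedIn (𝓞 L) v.asIdeal) {e : ℕ} (he : Valued.v (2 : v.adicCompletion ↥(maximalRealSubfield L)) = WithZero.exp (-(e : ℤ)))
    (J : GL (Fin 3) (w.1.adicCompletion L)) (hJ : J ∈ glInt 3 (w.1.adicCompletion L))
    (hJh : ((J : Matrix (Fin 3) (Fin 3) (w.1.adicCompletion L)).map (galAdicCompletionMap (L := L) (IsCMField.complexConj L) hw))ᵀ = J)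
    (τ : Matrix (Fin 3) (Fin 3) (w.1.adicCompletion L))
    (hτU : (τ.map (galAdicCompletionMap (L := L) (IsCMField.complexConj L) hw))ᵀ * (J : Matrix (Fin 3) (Fin 3) (w.1.adicCompletion L)) * τ = J)
    (hint : ∀ i, τ.charpoly.coeff i ∈ 𝒪[w.1.adicCompletion L])
    {u t D : w.1.adicCompletion L} (hχ : τ.charpoly = (X - C u) * (X ^ 2 - C t * X + C D))
    (hσu : galAdicCompletionMap (L := L) (IsCMField.complexConj L) hw u * u = 1)
    (hσD : D * galAdicCompletionMap (L := L) (IsCMField.complexConj L) hw D = 1)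
    (hσt : galAdicCompletionMap (L := L) (IsCMField.complexConj L) hw t = t * galAdicCompletionMap (L := L) (IsCMField.complexConj L) hw D)
    (hu1 : Valued.v (u - 1) < 1) (ht2 : Valued.v (t - 2) < 1) (hχ1 : Valued.v (1 - t + D) < 1)
    {n N : ℕ} (hn : Valued.v (u * u - t * u + D) = WithZero.exp (-(n : ℤ)))
    {w₀ : Fin 3 → w.1.adicCompletion L} (hK : IsUnit (Matrix.of fun i j : Fin 3 => ((τ ^ (j : ℕ)) *ᵥ w₀) i).det)
    {x₀ : Fin 3 → w.1.adicCompletion L} (hx₀ : τ *ᵥ x₀ = u • x₀) (hx₀0 : x₀ ≠ 0)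
    {y : w.1.adicCompletion L} {d₀ wd : v.adicCompletion ↥(maximalRealSubfield L)} (hdw : d₀ = 1 + wd) {k : ℕ}
    (hwd : Valued.v wd = WithZero.exp (-(2 * (k : ℤ) + 1))) (h4 : Valued.v (4 : v.adicCompletion ↥(maximalRealSubfield L)) < Valued.v wd)
    {k₀ : v.adicCompletion ↥(maximalRealSubfield L)} (hk₀ : Valued.v k₀ = WithZero.exp (-1 : ℤ))
    (hD : 4 * D = t * t - y * y * toPlace v w d₀)
    (hσy : galAdicCompletionMap (L := L) (IsCMField.complexConj L) hw y = -(y * galAdicCompletionMap (L := L) (IsCMField.complexConj L) hw D))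
    (hN : Valued.v y = WithZero.exp (-(N : ℤ))) (hNn : 1 ≤ N + k - e + n) :
    {Λ : Submodule 𝒪[w.1.adicCompletion L] (Fin 3 → w.1.adicCompletion L) |
        (∃ g ∈ unitaryGroupOfForm (galAdicCompletionMap (L := L) (IsCMField.complexConj L) hw) (J : Matrix (Fin 3) (Fin 3) (w.1.adicCompletion L)),
          Λ = Submodule.span 𝒪[w.1.adicCompletion L] (Set.range ((g : Matrix (Fin 3) (Fin 3) (w.1.adicCompletion L)))ᵀ)) ∧
        ∃ wv : Fin 3 → w.1.adicCompletion L, Λ = Submodule.span 𝒪[w.1.adicCompletion L] (Set.range fun j : Fin 3 => (τ ^ (j : ℕ)) *ᵥ wv)}.ncard =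
      if Even (WithZero.log (Valued.v (∑ k, ∑ i, galAdicCompletionMap (L := L) (IsCMField.complexConj L) hw (x₀ i) *
            (J : Matrix (Fin 3) (Fin 3) (w.1.adicCompletion L)) i k * x₀ k)) + n) then
        (Ideal.absNorm v.asIdeal + 1) * Ideal.absNorm v.asIdeal ^ (N + k - e + n - 1) else 0 := by
  classical
  have hιv : ∀ z : v.adicCompletion ↥(maximalRealSubfield L), Valued.v (toPlace v w z) = Valued.v z :=
    fun z => Liu2021.LemD1IndexedNonVacuityInertCofinite.valued_toPlace_of_isUnramifiedIn L v hv w z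
  -- `ι d₀ = 1 + ι wd` is NOT a square (★ (W0)), hence non-zero
  have hdw' : toPlace v w d₀ = 1 + toPlace v w wd := by rw [hdw, map_add, map_one]
  have hwd' : Valued.v (toPlace v w wd) = WithZero.exp (-(2 * (k : ℤ) + 1)) := by rw [hιv, hwd]
  have h4' : Valued.v (4 : w.1.adicCompletion L) < Valued.v (toPlace v w wd) := by rw [← map_ofNat (toPlace v w) 4, hιv, hιv]; exact h4
  have hdns : ¬ IsSquare (toPlace v w d₀) := by
    rw [hdw']; exact NumberFields.not_isSquare_one_add_of_valued_four_lt hwd' h4'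
  have hd0 : toPlace v w d₀ ≠ 0 := fun h0 => hdns ⟨0, by rw [h0, mul_zero]⟩
  -- ★ B-p08: a global `m ∈ L` in the square class of `ι d₀` (any residue characteristic); it is not a square
  obtain ⟨m, hm0, hsq⟩ := NumberFields.exists_isSquare_inv_mul_coe_of_ne_zero (w := w.1) hd0
  have hmns : ¬ IsSquare (algebraMap L (w.1.adicCompletion L) m) := by
    rintro ⟨b, hb⟩
    obtain ⟨a, ha⟩ := hsq
    have ha0 : a ≠ 0 := by
      rintro rfl
      rw [mul_zero] at ha
      exact (mul_ne_zero (inv_ne_zero hd0) ((_root_.map_ne_zero _).2 hm0)) ha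
    refine hdns ⟨b / a, ?_⟩
    have e1 : toPlace v w d₀ * (a * a) = b * b := by rw [← ha, ← hb, ← mul_assoc, mul_inv_cancel₀ hd0, one_mul]
    field_simp
    linear_combination e1
  have hnsq : ¬ IsSquare m := not_isSquare_of_not_isSquare_algebraMap m hmns
  haveI : Fact (Irreducible (X ^ 2 - C m : L[X])) := ⟨irreducible_X_sq_sub_C_of_not_isSquare m hnsq⟩
  haveI : NumberField (AdjoinRoot (X ^ 2 - C m : L[X])) := numberField_adjoinRoot m
  haveI : Algebra.IsQuadraticExtension L (AdjoinRoot (X ^ 2 - C m : L[X])) := isQuadraticExtension_adjoinRoot m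
  obtain ⟨c₁, hc₁, -⟩ := exists_algEquiv_root_eq_neg m
  have hδ0 : AdjoinRoot.root (X ^ 2 - C m : L[X]) ≠ 0 := root_X_sq_sub_C_ne_zero m
  have hmδ : algebraMap L (AdjoinRoot (X ^ 2 - C m : L[X])) m = (AdjoinRoot.root (X ^ 2 - C m : L[X])) ^ 2 := (root_X_sq_sub_C_sq m).symm
  obtain ⟨w₁⟩ : Nonempty (PlacesOver (AdjoinRoot (X ^ 2 - C m : L[X])) w.1) := inferInstance
  have hdm : IsSquare ((toPlace v w d₀)⁻¹ * (m : w.1.adicCompletion L)) := hsq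
  exact ncard_selfDual_cyclic_typeTwo_eq_ite_of_model_wildUnit L w hw hv he J hJ hJh τ hτU hint hχ hσu hσD hσt hu1 ht2 hχ1 hn hK hx₀ hx₀0
    hdw hwd h4 hk₀ hD hσy hN hNn c₁ hc₁ hδ0 hmδ hdm w₁

end Literature.NumberTheory.Rogawski1990

end
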